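import Literature.NumberTheory.LFunctions.SchoenfeldExplicitThm10Proofs
import Literature.NumberTheory.LFunctions.PrimeNumberTheoremErrorRHExplicit
import Literature.NumberTheory.LFunctions.ChebyshevThetaSqrtBounds
import HarnessLib

/-!
# RH-CONDITIONAL — Lee–Nosal 2026, Theorem 1.2 for large `x`, PROVED: under RH, `|ψ(x) − x| ≤ √x log x (log x − log log x)/(8π)` for `x ≥ 10¹⁰` and `|θ(x) − x| ≤` the same for `x ≥ 10¹⁴` («nothing here bears on the truth of RH»)

Topic `Literature/NumberTheory/LFunctions` (RH literature-typing tranche 1, L4 "explicit prime-counting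
consequences", gen 10). Label **RH-CONDITIONAL** (every statement has `RiemannHypothesis` as a
hypothesis). THEOREMS only: no definitions, no new named facts. Nothing here bears on the truth of RH.

`PrimeNumberTheoremErrorRHExplicit.lean` types E. S. Lee and P. Nosal, *Sharper bounds for the error
in the prime number theorem assuming the Riemann Hypothesis*, J. Number Theory 283 (2026) 241–258,
Theorem 1.2, as the named fact `LeeNosal2026_thm12`: under RH,
`|ψ(x) − x| ≤ 𝓑(x) := √x log x (log x − log log x)/(8π)` for `x ≥ 101` and `|θ(x) − x| ≤ 𝓑(x)` for
`x ≥ 2657` (a saving of `log log x` over Schoenfeld's `(log x − 2)`). This file PROVES the theorem in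
the kernel for all large `x`, from the tree's RH machinery behind Schoenfeld's Theorem 10
(`SchoenfeldExplicitThm10Proofs.lean`), with a different choice of parameters:

* **`LeeNosalThm12.psi_large`**: RH ⇒ `|ψ(x) − x| ≤ 𝓑(x)` for `x ≥ 10¹⁰`
  (`abs_psi_sub_le_of_exp_le`: for `x ≥ e²³`);
* **`LeeNosalThm12.theta_large`**: RH ⇒ `|θ(x) − x| ≤ 𝓑(x)` for `x ≥ 10¹⁴`
  (`abs_theta_sub_le_of_exp_le`: for `x ≥ e³⁰`);
* **`LeeNosalThm12.psi_of_buthe`**, **`theta_of_buthe`**: RH and Büthe's unconditional, computer-assisted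
  Theorem 2 (`Buthe2018_thm2_psi`: `|x − ψ(x)| ≤ 0.94√x`, `11 < x ≤ 10¹⁹`; `Buthe2018_thm2_theta`:
  `0.05√x < x − θ(x) ≤ 1.95√x`, `1423 ≤ x ≤ 10¹⁹`) ⇒ the `ψ`-bound for `x ≥ 350` and the `θ`-bound for
  `x ≥ 3500` (`0.94√x ≤ 𝓑(x)` from `x = 350`, `1.95√x ≤ 𝓑(x)` from `x = 3500`).

METHOD (Schoenfeld 1976, proof of Thm. 10, with Lee–Nosal's balance of the two zero sums). Write
`r = √x`, `L = log x`, `m = log L`. The explicit formula for `ψ₁ = ∫ψ` differenced once with step `h`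
(`SchoenfeldBound.psi_sub_self_le`, `neg_le_psi_sub_self`, `SchoenfeldPsiDifference.lean`) gives, under
RH and for any `T`,
`|ψ(x) − x| ≲ h/2 + √x·∑_{|γ|≤T} 1/|ρ| + (2x^{3/2}/h)·∑_{|γ|>T} 1/|ρ|²`; the tree's explicit zero sums
(`sumInvNorm_le_explicit`: `∑_{|γ|≤T} 1/|ρ| ≤ log²(T/2π)/(2π) + C₁`, `C₁ ≤ 0.04002`; `tail_le_explicit`:
`∑_{|γ|>T} 1/|ρ|² ≤ 2G(T) = (log(T/2π)+1)/(πT) + O(log T/T²)`, both for `T ≥ 2516`, resting on the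
`2000` certified zeros) are fed with **`T = 2πr/L`** (so `log(T/2π) = L/2 − m`) and **`h = rL/π`**.
Per unit `√x` the three terms are `L/(2π)`, `(L/2 − m)²/(2π) + C₁` and `(L/2 − m + 1)/π`, whose sum is
`L²/(8π) − Lm/(2π) + 3L/(2π) + (m² − 2m + 2)/(2π) + C₁`, against Lee–Nosal's `L²/(8π) − Lm/(8π)`:
the margin `(3Lm/4 − 2L + 2m − m² − 2 − 2πC₁)/(2π)` is positive from `L ≈ 21` on and exceeds
`0.1 + (all lower-order terms)/√x` for `L ≥ 23` (`key_psi`, `junk_aux`: the lower-order terms are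
`≤ 1.84 + 0.007L³ + 2.34L² + 24.3L ≤ 0.1√x`). For `θ`, `ψ − θ ≤ ψ(√x) + ψ(x^{1/3}) + ψ(x^{1/5}) ≤ 1.0541√x`
(`psi_le_mul`: `ψ(y) ≤ 1.04y` under RH; `x ≥ e³⁰`) is absorbed by the margin from `L = 30` on
(`key_theta`). Constants: kernel enclosures of `log 23, log 30, log 10, log 350, log 3500, log 6, log 9`
(`KernelLog.logIv`), `log 2π ≤ 1.8378772` and `C₁ ≤ 0.04002` (`SchoenfeldThm10`), `e ≥ 2.7182818283`.

KERNEL STATUS of `LeeNosal2026_thm12` after this file: the `ψ`-line is a theorem for `x ≥ 10¹⁰` and,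
modulo the named fact `Buthe2018_thm2_psi`, for `x ≥ 350`; the `θ`-line is a theorem for `x ≥ 10¹⁴`
and, modulo `Buthe2018_thm2_theta`, for `x ≥ 3500`. What is missing for `LeeNosal2026_thm12_holds`
(besides Büthe's facts, which are numerical verifications of `ψ, θ` against `√x` up to `10¹⁹` and not
kernel material): the windows `101 ≤ x < 350` (`ψ`) and `2657 ≤ x < 3500` (`θ`), i.e. a run of the
tabulated-`ψ`/`θ` checkers (`SchoenfeldPsiTable.PsiChain`, `ThetaChain`) with the comparison function
`√q log q (log q − log log q)/(8π)` in place of Schoenfeld's `√q log² q/(8π)` — TODO (a new `chkB` with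
an upper enclosure of `log log q`).

Computational dependencies (inherited, declared `computational` upstream): the certified first `2000`
zeros of `ζ` (`MertensCertificate`, `native_decide`) behind `SchoenfeldZerosLow.lean`, exactly as for
`Schoenfeld1976_thm10_holds`.

## References

* E. S. Lee, P. Nosal, *Sharper bounds for the error in the prime number theorem assuming the Riemann
  Hypothesis*, J. Number Theory 283 (2026) 241–258 (arXiv:2312.05628v4), Thm. 1.2. [LeeNosal2026]
* L. Schoenfeld, *Sharper bounds for the Chebyshev functions θ(x) and ψ(x). II*, Math. Comp. 30
  (1976), 337–360, Thm. 10 and its proof ((6.6)–(6.14)), Lemma 9. [Schoenfeld1976]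
* J. Büthe, *An analytic method for bounding ψ(x)*, Math. Comp. 87 (2018), 1991–2009, Thm. 2. [Buthe2018]
-/

noncomputable section

open Real
open scoped Chebyshev

namespace Literature.NumberTheory.LFunctions

namespace LeeNosalThm12

open SchoenfeldBound NicolasJExplicit SchoenfeldMid SchoenfeldLarge SchoenfeldThm10

/-! ### Numerical constants -/

/-- `3.1354942 ≤ log 23` (kernel enclosure). [folklore] -/
private theorem log_23_ge : (3.1354942 : ℝ) ≤ Real.log 23 := by
  have h1 : Literature.Analysis.SpecialFunctions.KernelLog.logIv 23 =
      some (3790579914888838637257629, 3790579914889314243177031) := by decide +kernel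
  have hA := (Literature.Analysis.SpecialFunctions.KernelLog.logIv_sound h1).1
  simp only [Nat.cast_ofNat] at hA
  norm_num at hA ⊢
  linarith

/-- `2.302585 ≤ log 10` (kernel enclosure). [folklore] -/
private theorem log_ten_ge : (2.302585 : ℝ) ≤ Real.log 10 := by
  have h1 : Literature.Analysis.SpecialFunctions.KernelLog.logIv 10 =
      some (2783654570780016011168420, 2783654570780491616991106) := by decide +kernel
  have hA := (Literature.Analysis.SpecialFunctions.KernelLog.logIv_sound h1).1
  simp only [Nat.cast_ofNat] at hA
  norm_num at hA ⊢
  linarith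

/-- `3.4011973 ≤ log 30` (kernel enclosure). [folklore] -/
private theorem log_30_ge : (3.4011973 : ℝ) ≤ Real.log 30 := by
  have h1 : Literature.Analysis.SpecialFunctions.KernelLog.logIv 30 =
      some (4111795332296814105287541, 4111795332297289711206943) := by decide +kernel
  have hA := (Literature.Analysis.SpecialFunctions.KernelLog.logIv_sound h1).1
  simp only [Nat.cast_ofNat] at hA
  norm_num at hA ⊢
  linarith

/-- `5.857933 ≤ log 350` (kernel enclosure). [folklore] -/
private theorem log_350_ge : (5.857933 : ℝ) ≤ Real.log 350 := by
  have h1 : Literature.Analysis.SpecialFunctions.KernelLog.logIv 350 =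
      some (7081806640031390519809887, 7081806640031866125922721) := by decide +kernel
  have hA := (Literature.Analysis.SpecialFunctions.KernelLog.logIv_sound h1).1
  simp only [Nat.cast_ofNat] at hA
  norm_num at hA ⊢
  linarith

/-- `8.160518 ≤ log 3500` (kernel enclosure). [folklore] -/
private theorem log_3500_ge : (8.160518 : ℝ) ≤ Real.log 3500 := by
  have h1 : Literature.Analysis.SpecialFunctions.KernelLog.logIv 3500 =
      some (9865461210811642266451239, 9865461210812117872709147) := by decide +kernel
  have hA := (Literature.Analysis.SpecialFunctions.KernelLog.logIv_sound h1).1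
  simp only [Nat.cast_ofNat] at hA
  norm_num at hA ⊢
  linarith

/-- `log 6 ≤ 1.7917595` (kernel enclosure). [folklore] -/
private theorem log_6_le : Real.log 6 ≤ 1.7917595 := by
  have h1 : Literature.Analysis.SpecialFunctions.KernelLog.logIv 6 =
      some (2166104284888561533852022, 2166104284889037139674708) := by decide +kernel
  have hA := (Literature.Analysis.SpecialFunctions.KernelLog.logIv_sound h1).2
  simp only [Nat.cast_ofNat] at hA
  norm_num at hA ⊢
  linarith

/-- `log 9 ≤ 2.1972246` (kernel enclosure). [folklore] -/
private theorem log_9_le : Real.log 9 ≤ 2.1972246 := by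
  have h1 : Literature.Analysis.SpecialFunctions.KernelLog.logIv 9 =
      some (2656281523033358381414648, 2656281523033833987237334) := by decide +kernel
  have hA := (Literature.Analysis.SpecialFunctions.KernelLog.logIv_sound h1).2
  simp only [Nat.cast_ofNat] at hA
  norm_num at hA ⊢
  linarith

/-- `exp 23 ≤ 10¹⁰` (`23 ≤ 10 log 10`). [folklore] -/
private theorem exp_23_le_ten_pow_ten : Real.exp 23 ≤ (10 : ℝ) ^ 10 := by
  have h : (23 : ℝ) ≤ Real.log ((10 : ℝ) ^ 10) := by
    rw [Real.log_pow]; push_cast; linarith [log_ten_ge]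
  calc Real.exp 23 ≤ Real.exp (Real.log ((10 : ℝ) ^ 10)) := Real.exp_le_exp.2 h
    _ = (10 : ℝ) ^ 10 := Real.exp_log (by positivity)

/-- `e^{23/2} ≥ 97000` (`e ≥ 2.7182818283`, `e^{1/2} ≥ 1 + 1/2 + 1/8`). [folklore] -/
private theorem exp_23_half_ge : (97000 : ℝ) ≤ Real.exp (23 / 2) := by
  have h1 : Real.exp (23 / 2) = Real.exp 1 ^ 11 * Real.exp (1 / 2) := by
    rw [← Real.exp_nat_mul, ← Real.exp_add]; norm_num
  have h2 : (2.7182818283 : ℝ) ^ 11 ≤ Real.exp 1 ^ 11 :=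
    pow_le_pow_left₀ (by norm_num) Real.exp_one_gt_d9.le 11
  have h3 : (1.625 : ℝ) ≤ Real.exp (1 / 2) := by
    have := Real.quadratic_le_exp_of_nonneg (by norm_num : (0 : ℝ) ≤ 1 / 2)
    norm_num at this ⊢
    linarith
  rw [h1]
  calc (97000 : ℝ) ≤ 2.7182818283 ^ 11 * 1.625 := by norm_num
    _ ≤ Real.exp 1 ^ 11 * Real.exp (1 / 2) := mul_le_mul h2 h3 (by norm_num) (by positivity)

/-- For `L ≥ 23`: `e^{L/2} ≥ 97000 (1 + (L − 23)/6)³` (`e^{u} ≥ (1 + u/3)³`). [folklore] -/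
private theorem exp_half_ge {L : ℝ} (hL : 23 ≤ L) :
    97000 * (1 + (L - 23) / 6) ^ 3 ≤ Real.exp (L / 2) := by
  have h1 : Real.exp (L / 2) = Real.exp (23 / 2) * Real.exp ((L - 23) / 6) ^ 3 := by
    rw [← Real.exp_nat_mul, ← Real.exp_add]; congr 1; push_cast; ring
  have h2 : 1 + (L - 23) / 6 ≤ Real.exp ((L - 23) / 6) := by
    linarith [Real.add_one_le_exp ((L - 23) / 6)]
  have h3 := pow_le_pow_left₀ (by linarith) h2 3
  rw [h1]
  exact mul_le_mul exp_23_half_ge h3 (by positivity) (by positivity)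

/-- `log L ≤ L/2` for `L > 0` (`e^{L/2} ≥ 1 + L/2 + L²/8 ≥ L`). [folklore] -/
private theorem log_le_half {L : ℝ} (hL : 0 < L) : Real.log L ≤ L / 2 := by
  rw [Real.log_le_iff_le_exp hL]
  have := Real.quadratic_le_exp_of_nonneg (by linarith : (0 : ℝ) ≤ L / 2)
  nlinarith

/-- The small terms are at most `0.1 √x`: for `L ≥ 23` and `r ≥ 97000(1 + (L−23)/6)³`,
`1.84 + 0.007 L³ + 2.34 L² + 24.3 L ≤ 0.1 r`. [folklore] -/
private theorem junk_le_tenth {L r : ℝ} (hL : 23 ≤ L) (hr : 97000 * (1 + (L - 23) / 6) ^ 3 ≤ r) :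
    1.84 + 0.007 * L ^ 3 + 2.34 * L ^ 2 + 24.3 * L ≤ 0.1 * r := by
  obtain ⟨w, hw, rfl⟩ : ∃ w : ℝ, 0 ≤ w ∧ L = 23 + w := ⟨L - 23, by linarith, by ring⟩
  have hw2 : 0 ≤ w ^ 2 := sq_nonneg w
  have hw3 : 0 ≤ w ^ 3 := pow_nonneg hw 3
  nlinarith [hw2, hw3]

/-- **The key inequality for `ψ`** (per unit `√x`): for `L ≥ 23`, `3.1354942 ≤ m ≤ L/2`, `C ≤ 0.04002`,
`L/(2π) + (L/2 − m)²/(2π) + C + (L/2 − m + 1)/π + 0.1 ≤ L(L − m)/(8π)`; equivalently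
`3Lm − 8L − 4m² + 8m − 8 − 8πC − 0.8π ≥ 0`, which is increasing in `m` on this range and, at
`m = 3.1354942`, at least `1.406 L − 25.77 > 0`. [folklore] -/
private theorem key_psi {L m C : ℝ} (hL : 23 ≤ L) (hm : 3.1354942 ≤ m) (hmL : m ≤ L / 2)
    (hC : C ≤ 0.04002) :
    L / (2 * π) + ((L / 2 - m) ^ 2 / (2 * π) + C) + (L / 2 - m + 1) / π + 0.1 ≤
      L * (L - m) / (8 * π) := by
  have hπ := Real.pi_pos
  have hπ4 := Real.pi_lt_d2
  have hπC : π * C ≤ π * 0.04002 := mul_le_mul_of_nonneg_left hC hπ.le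
  have hprod : 0 ≤ (m - 3.1354942) * (3 * L - 4 * m - 4 * 3.1354942 + 8) :=
    mul_nonneg (by linarith) (by linarith)
  have key : 0 ≤ 3 * L * m - 8 * L - 4 * m ^ 2 + 8 * m - 8 - 8 * π * C - 0.8 * π := by
    nlinarith [hprod, hπC]
  rw [← sub_nonneg]
  have e : L * (L - m) / (8 * π) - (L / (2 * π) + ((L / 2 - m) ^ 2 / (2 * π) + C) +
      (L / 2 - m + 1) / π + 0.1) =
      (3 * L * m - 8 * L - 4 * m ^ 2 + 8 * m - 8 - 8 * π * C - 0.8 * π) / (8 * π) := by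
    field_simp
    ring
  rw [e]
  positivity

/-- **The key inequality for `θ`** (per unit `√x`): for `L ≥ 30`, `3.4011973 ≤ m ≤ L/2`, `C ≤ 0.04002`,
`L/(2π) + (L/2 − m)²/(2π) + C + (L/2 − m + 1)/π + 0.1 + 1.0541 ≤ L(L − m)/(8π)` (the extra `1.0541`
absorbs `ψ − θ ≤ 1.04(√x + x^{1/3} + x^{1/5})`). [folklore] -/
private theorem key_theta {L m C : ℝ} (hL : 30 ≤ L) (hm : 3.4011973 ≤ m) (hmL : m ≤ L / 2)
    (hC : C ≤ 0.04002) :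
    L / (2 * π) + ((L / 2 - m) ^ 2 / (2 * π) + C) + (L / 2 - m + 1) / π + 0.1 + 1.0541 ≤
      L * (L - m) / (8 * π) := by
  have hπ := Real.pi_pos
  have hπ4 := Real.pi_lt_d2
  have hπC : π * C ≤ π * 0.04002 := mul_le_mul_of_nonneg_left hC hπ.le
  have hprod : 0 ≤ (m - 3.4011973) * (3 * L - 4 * m - 4 * 3.4011973 + 8) :=
    mul_nonneg (by linarith) (by linarith)
  have key : 0 ≤ 3 * L * m - 8 * L - 4 * m ^ 2 + 8 * m - 8 - 8 * π * C - 0.8 * π - 8 * π * 1.0541 := by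
    nlinarith [hprod, hπC]
  rw [← sub_nonneg]
  have e : L * (L - m) / (8 * π) - (L / (2 * π) + ((L / 2 - m) ^ 2 / (2 * π) + C) +
      (L / 2 - m + 1) / π + 0.1 + 1.0541) =
      (3 * L * m - 8 * L - 4 * m ^ 2 + 8 * m - 8 - 8 * π * C - 0.8 * π - 8 * π * 1.0541) / (8 * π) := by
    field_simp
    ring
  rw [e]
  positivity

/-! ### The differenced explicit formula with `T = 2π√x/log x`, `h = √x log x/π` -/

/-- The zero sums at `T = 2πr/L` (`r = √x`, `L = log x`, `m = log L`, `r ≥ 401 L` so `T ≥ 2516`):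
`∑_{|γ|≤T} 1/|ρ| ≤ (L/2 − m)²/(2π) + C₁` and, under RH,
`0 ≤ ∑_{|γ|>T} 1/|ρ|² ≤ 2G(T) ≤ 2[(L/2 − m + 1)/(2π)·(L/(2πr)) + (72.535 + 6.67L)(L/(2πr))² + 0.62083(L/(2πr))³]`
(`log(T/2π) = L/2 − m`, `log T ≤ L/2`). [cite: Schoenfeld1976, Lemma 9] -/
theorem zeros_aux (hRH : RiemannHypothesis) {r L m : ℝ} (hr0 : 0 < r) (hL0 : 0 < L)
    (hlogr : Real.log r = L / 2) (hm : m = Real.log L) (hm2 : 1.8378772 ≤ m) (hrL : 401 * L ≤ r) :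
    sumInvNorm (2 * π * r / L) ≤ ((L / 2 - m) ^ 2 / (2 * π) + C1) ∧ 0 ≤ sumInvNorm (2 * π * r / L) ∧
      0 ≤ nicolasBeta - sumInvNormSq (2 * π * r / L) ∧
      nicolasBeta - sumInvNormSq (2 * π * r / L) ≤
        2 * ((L / 2 - m + 1) / (2 * π) * (L / (2 * π * r)) + (2 * 34.6 + 6.67 / 2 + 2 * 6.67 * (L / 2)) * (L / (2 * π * r)) ^ 2 +
        5 * 0.3725 / 3 * (L / (2 * π * r)) ^ 3) := by
  have hπ := Real.pi_pos
  have hπ3 := Real.pi_gt_d2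
  obtain ⟨T, hT_def⟩ : ∃ T : ℝ, T = 2 * π * r / L := ⟨_, rfl⟩
  rw [← hT_def]
  have hπr : 3.14 * (401 * L) ≤ π * r := mul_le_mul hπ3.le hrL (by linarith) hπ.le
  have hT : 2516 ≤ T := by
    rw [hT_def, le_div_iff₀ hL0]; linarith
  have hT0 : 0 < T := by linarith
  have hT2π : T / (2 * π) = r / L := by
    rw [hT_def]; field_simp
  have hlogT2π : Real.log (T / (2 * π)) = L / 2 - m := by
    rw [hT2π, Real.log_div hr0.ne' hL0.ne', hlogr, hm]
  have hlogT : Real.log T ≤ L / 2 := by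
    have e : T = 2 * π * (r / L) := by rw [hT_def]; ring
    rw [e, Real.log_mul (by positivity) (div_pos hr0 hL0).ne', Real.log_div hr0.ne' hL0.ne', hlogr,
      ← hm]
    have := log_two_pi_bounds.2
    linarith
  have hA : sumInvNorm T ≤ ((L / 2 - m) ^ 2 / (2 * π) + C1) := by
    have := sumInvNorm_le_explicit hT; rwa [hlogT2π] at this
  have hB := tail_le_explicit hRH hT
  have hTinv : T⁻¹ = L / (2 * π * r) := by rw [hT_def, inv_div]
  have hG : Gtail T ≤ ((L / 2 - m + 1) / (2 * π) * (L / (2 * π * r)) + (2 * 34.6 + 6.67 / 2 + 2 * 6.67 * (L / 2)) * (L / (2 * π * r)) ^ 2 +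
        5 * 0.3725 / 3 * (L / (2 * π * r)) ^ 3) := by
    simp only [Gtail]
    rw [hlogT2π, ← inv_pow, ← inv_pow, hTinv]
    have h2 : 0 ≤ (L / (2 * π * r)) ^ 2 := sq_nonneg _
    have : (2 * 34.6 + 6.67 / 2 + 2 * 6.67 * Real.log T) * (L / (2 * π * r)) ^ 2 ≤
        (2 * 34.6 + 6.67 / 2 + 2 * 6.67 * (L / 2)) * (L / (2 * π * r)) ^ 2 :=
      mul_le_mul_of_nonneg_right (by linarith) h2
    linarith
  exact ⟨hA, sumInvNorm_nonneg T, sub_nonneg.2 (sumInvNormSq_le_nicolasBeta hRH _), by linarith⟩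

/-- **Lower side**: under RH, with `x = r²`, `L = log x ≥ 23`, `m = log L`, `r ≥ 401 L`,
`x − ψ(x) ≤ rL/(2π) + log 2π + r((L/2 − m)²/(2π) + C₁) + r(L/2 − m + 1)/π + (72.535 + 6.67L)L/π + 0.62083L²/(2π²r)`
(`neg_le_psi_sub_self` with `h = rL/π`, `T = 2πr/L`). [cite: Schoenfeld1976, Thm. 10 (proof, pp. 337–339)] -/
theorem lower_aux (hRH : RiemannHypothesis) {x r L m : ℝ} (hx1 : 1 < x) (hrx : r ^ 2 = x)
    (hr0 : 0 < r) (hL0 : 0 < L) (hlogr : Real.log r = L / 2) (hm : m = Real.log L)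
    (hm2 : 1.8378772 ≤ m) (hrL : 401 * L ≤ r) (hL23 : 23 ≤ L) :
    x - ψ x ≤ r * L / (2 * π) + Real.log (2 * π) + r * ((L / 2 - m) ^ 2 / (2 * π) + C1) +
      (r * (L / 2 - m + 1) / π + (2 * 34.6 + 6.67 / 2 + 2 * 6.67 * (L / 2)) * L / π + 5 * 0.3725 / 3 * L ^ 2 / (2 * π ^ 2 * r)) := by
  have hπ := Real.pi_pos
  have hπ3 := Real.pi_gt_d2
  have hx0 : 0 < x := by linarith
  obtain ⟨hA, -, -, hB⟩ := zeros_aux hRH hr0 hL0 hlogr hm hm2 hrL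
  obtain ⟨h, hh_def⟩ : ∃ h : ℝ, h = r * L / π := ⟨_, rfl⟩
  have hh0 : 0 < h := by rw [hh_def]; exact div_pos (mul_pos hr0 hL0) hπ
  have hh3 : h ≤ r * L / 3 := by
    rw [hh_def]
    exact div_le_div_of_nonneg_left (mul_nonneg hr0.le hL0.le) (by norm_num) (by linarith)
  have hxh : 1 < x - h := by
    have h1 : r * (400 * L) ≤ r * (r - L / 3) :=
      mul_le_mul_of_nonneg_left (by linarith) hr0.le
    have hrl : 401 * L * 23 ≤ r * L := mul_le_mul hrL hL23 (by norm_num) hr0.le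
    rw [← hrx]
    linarith
  have hx32 : x ^ (3 / 2 : ℝ) = r ^ 3 := by
    have e1 : x ^ (3 / 2 : ℝ) = x * Real.sqrt x := by
      rw [show (3 / 2 : ℝ) = 1 + 1 / 2 by norm_num, Real.rpow_add hx0, Real.rpow_one,
        ← Real.sqrt_eq_rpow]
    have e2 : Real.sqrt x = r := by rw [← hrx, Real.sqrt_sq hr0.le]
    rw [e1, e2]
    linear_combination (-r) * hrx
  have hsx : Real.sqrt x = r := by rw [← hrx, Real.sqrt_sq hr0.le]
  have h0 := neg_le_psi_sub_self hRH hh0 hxh (2 * π * r / L)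
  rw [hx32, hsx] at h0
  have h1 : r * sumInvNorm (2 * π * r / L) ≤ r * ((L / 2 - m) ^ 2 / (2 * π) + C1) := mul_le_mul_of_nonneg_left hA hr0.le
  have hr3h : 0 ≤ 2 * r ^ 3 / h := div_nonneg (mul_nonneg (by norm_num) (pow_nonneg hr0.le 3)) hh0.le
  have h2 := mul_le_mul_of_nonneg_left hB hr3h
  have hclosed : 2 * r ^ 3 / h * (2 * ((L / 2 - m + 1) / (2 * π) * (L / (2 * π * r)) + (2 * 34.6 + 6.67 / 2 + 2 * 6.67 * (L / 2)) * (L / (2 * π * r)) ^ 2 +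
        5 * 0.3725 / 3 * (L / (2 * π * r)) ^ 3)) =
      (r * (L / 2 - m + 1) / π + (2 * 34.6 + 6.67 / 2 + 2 * 6.67 * (L / 2)) * L / π + 5 * 0.3725 / 3 * L ^ 2 / (2 * π ^ 2 * r)) := by
    rw [hh_def]
    field_simp
  rw [hclosed] at h2
  have h3 : h / 2 = r * L / (2 * π) := by rw [hh_def]; ring
  linarith only [h0, h1, h2, h3]

/-- **Upper side**: under RH, with the same data,
`ψ(x) − x ≤ rL/(2π) − log 2π + (r + L/(2π))((L/2 − m)²/(2π) + C₁) + (W + 2L(L/2 − m + 1)/π² + (J₂+J₃)/600) + 1`,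
`W = r(L/2 − m + 1)/π + J₂ + J₃`, `J₂ = (72.535 + 6.67L)L/π`, `J₃ = 0.62083L²/(2π²r)`
(`psi_sub_self_le` with `h = rL/π`, `T = 2πr/L`; `√(x+h) ≤ r + L/(2π)`, `(x+h)^{3/2} ≤ (x+h)(r + L/(2π))`,
`x/(2h(x²−1)) ≤ 1`). [cite: Schoenfeld1976, Thm. 10 (proof, pp. 337–339)] -/
theorem upper_aux (hRH : RiemannHypothesis) {x r L m : ℝ} (hx1 : 1 < x) (hx2 : 2 ≤ x)
    (hrx : r ^ 2 = x) (hr0 : 0 < r) (hL0 : 0 < L) (hlogr : Real.log r = L / 2) (hm : m = Real.log L)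
    (hm2 : 1.8378772 ≤ m) (hmL : m ≤ L / 2) (hrL : 401 * L ≤ r) (hL23 : 23 ≤ L) :
    ψ x - x ≤ r * L / (2 * π) - Real.log (2 * π) + (r + L / (2 * π)) * ((L / 2 - m) ^ 2 / (2 * π) + C1) +
      ((r * (L / 2 - m + 1) / π + (2 * 34.6 + 6.67 / 2 + 2 * 6.67 * (L / 2)) * L / π + 5 * 0.3725 / 3 * L ^ 2 / (2 * π ^ 2 * r)) +
        2 * L * (L / 2 - m + 1) / π ^ 2 + ((2 * 34.6 + 6.67 / 2 + 2 * 6.67 * (L / 2)) * L / π + 5 * 0.3725 / 3 * L ^ 2 / (2 * π ^ 2 * r)) / 600) + 1 := by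
  have hπ := Real.pi_pos
  have hπ3 := Real.pi_gt_d2
  have hπ4 := Real.pi_lt_d2
  have hx0 : 0 < x := by linarith
  obtain ⟨hA, hA0, hB0, hB⟩ := zeros_aux hRH hr0 hL0 hlogr hm hm2 hrL
  have hπr : 3.14 * (401 * L) ≤ π * r := mul_le_mul hπ3.le hrL (by linarith) hπ.le
  have hrl : 401 * L * 23 ≤ r * L := mul_le_mul hrL hL23 (by norm_num) hr0.le
  obtain ⟨h, hh_def⟩ : ∃ h : ℝ, h = r * L / π := ⟨_, rfl⟩
  have hh0 : 0 < h := by rw [hh_def]; exact div_pos (mul_pos hr0 hL0) hπ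
  -- names for the small terms
  obtain ⟨J₂, hJ₂_def⟩ : ∃ J₂ : ℝ, J₂ = (2 * 34.6 + 6.67 / 2 + 2 * 6.67 * (L / 2)) * L / π :=
    ⟨_, rfl⟩
  obtain ⟨J₃, hJ₃_def⟩ : ∃ J₃ : ℝ, J₃ = 5 * 0.3725 / 3 * L ^ 2 / (2 * π ^ 2 * r) := ⟨_, rfl⟩
  obtain ⟨W, hW_def⟩ : ∃ W : ℝ, W = r * (L / 2 - m + 1) / π + J₂ + J₃ := ⟨_, rfl⟩
  rw [← hJ₂_def, ← hJ₃_def, ← hW_def]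
  have hv0 : 0 ≤ L / 2 - m + 1 := by linarith
  have hJ₂0 : 0 ≤ J₂ := by
    rw [hJ₂_def]; exact div_nonneg (mul_nonneg (by linarith) hL0.le) hπ.le
  have hJ₃0 : 0 ≤ J₃ := by
    rw [hJ₃_def]; exact div_nonneg (by positivity) (mul_nonneg (by positivity) hr0.le)
  have hW0 : 0 ≤ W := by
    rw [hW_def]
    have : 0 ≤ r * (L / 2 - m + 1) / π := div_nonneg (mul_nonneg hr0.le hv0) hπ.le
    linarith
  have hclosed : 2 * r ^ 3 / h * (2 * ((L / 2 - m + 1) / (2 * π) * (L / (2 * π * r)) + (2 * 34.6 + 6.67 / 2 + 2 * 6.67 * (L / 2)) * (L / (2 * π * r)) ^ 2 +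
        5 * 0.3725 / 3 * (L / (2 * π * r)) ^ 3)) = W := by
    rw [hW_def, hJ₂_def, hJ₃_def, hh_def]
    field_simp
  obtain ⟨a, ha_def⟩ : ∃ a : ℝ, a = L / (π * r) := ⟨_, rfl⟩
  have ha0 : 0 ≤ a := by rw [ha_def]; exact div_nonneg hL0.le (mul_nonneg hπ.le hr0.le)
  have ha1 : a ≤ 1 / 1200 := by
    rw [ha_def, div_le_iff₀ (mul_pos hπ hr0)]; linarith
  have hrL2π : 0 ≤ r + L / (2 * π) := add_nonneg hr0.le (div_nonneg hL0.le (by positivity))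
  have h0 := psi_sub_self_le hRH hx1 hh0 (2 * π * r / L)
  -- `√(x+h) ≤ r + L/(2π)`
  have hy0 : 0 ≤ x + h := by linarith
  have hsq : Real.sqrt (x + h) ≤ r + L / (2 * π) := by
    have e : x + h ≤ (r + L / (2 * π)) ^ 2 := by
      rw [← hrx, hh_def]
      have : (r + L / (2 * π)) ^ 2 = r ^ 2 + r * L / π + (L / (2 * π)) ^ 2 := by ring
      rw [this]; linarith [sq_nonneg (L / (2 * π))]
    calc Real.sqrt (x + h) ≤ Real.sqrt ((r + L / (2 * π)) ^ 2) := Real.sqrt_le_sqrt e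
      _ = r + L / (2 * π) := Real.sqrt_sq hrL2π
  have h1 : Real.sqrt (x + h) * sumInvNorm (2 * π * r / L) ≤ (r + L / (2 * π)) * ((L / 2 - m) ^ 2 / (2 * π) + C1) :=
    mul_le_mul hsq hA hA0 hrL2π
  -- `(x+h)^{3/2} ≤ (x+h)(r + L/(2π))`
  have h32 : (x + h) ^ (3 / 2 : ℝ) ≤ (x + h) * (r + L / (2 * π)) := by
    rw [show (3 / 2 : ℝ) = 1 + 1 / 2 by norm_num, Real.rpow_add' hy0 (by norm_num), Real.rpow_one,
      ← Real.sqrt_eq_rpow]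
    exact mul_le_mul_of_nonneg_left hsq hy0
  have h2 : 2 * (x + h) ^ (3 / 2 : ℝ) / h * (nicolasBeta - sumInvNormSq (2 * π * r / L)) ≤
      2 * ((x + h) * (r + L / (2 * π))) / h *
        (2 * ((L / 2 - m + 1) / (2 * π) * (L / (2 * π * r)) + (2 * 34.6 + 6.67 / 2 + 2 * 6.67 * (L / 2)) * (L / (2 * π * r)) ^ 2 +
        5 * 0.3725 / 3 * (L / (2 * π * r)) ^ 3)) := by
    apply mul_le_mul _ hB hB0
      (div_nonneg (mul_nonneg (by norm_num) (mul_nonneg hy0 hrL2π)) hh0.le)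
    apply div_le_div_of_nonneg_right _ hh0.le
    linarith
  have hclosedU : 2 * ((x + h) * (r + L / (2 * π))) / h *
      (2 * ((L / 2 - m + 1) / (2 * π) * (L / (2 * π * r)) + (2 * 34.6 + 6.67 / 2 + 2 * 6.67 * (L / 2)) * (L / (2 * π * r)) ^ 2 +
        5 * 0.3725 / 3 * (L / (2 * π * r)) ^ 3)) =
      (1 + a) * (1 + a / 2) * W := by
    rw [← hclosed, ha_def, ← hrx, hh_def]
    field_simp
  rw [hclosedU] at h2
  have h3' : (1 + a) * (1 + a / 2) ≤ 1 + 2 * a := by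
    have := mul_le_mul_of_nonneg_left (show a / 2 ≤ 1 / 2 by linarith) ha0
    linarith
  have h3 : (1 + a) * (1 + a / 2) * W ≤ (1 + 2 * a) * W := mul_le_mul_of_nonneg_right h3' hW0
  have h4 : (1 + 2 * a) * W = W + 2 * L * (L / 2 - m + 1) / π ^ 2 + 2 * a * (J₂ + J₃) := by
    rw [hW_def, ha_def]
    field_simp
    ring
  have h5 : 2 * a * (J₂ + J₃) ≤ (J₂ + J₃) / 600 := by
    have := mul_le_mul_of_nonneg_right (show 2 * a ≤ 1 / 600 by linarith)
      (show 0 ≤ J₂ + J₃ by linarith)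
    linarith
  -- the remainder `x/(2h(x²−1)) ≤ 1`
  have h6 : x / (2 * h * (x ^ 2 - 1)) ≤ 1 := by
    have h1h : 1 ≤ h := by
      rw [hh_def, le_div_iff₀ hπ]; linarith
    have hx2' : x ≤ x ^ 2 - 1 := by
      have := mul_le_mul_of_nonneg_left hx2 hx0.le
      linarith
    have hx21 : 0 < x ^ 2 - 1 := by linarith only [hx2', hx0]
    have hpos : 0 < 2 * h * (x ^ 2 - 1) := mul_pos (mul_pos two_pos hh0) hx21
    rw [div_le_one hpos]
    have := mul_le_mul h1h hx2' hx0.le (by linarith only [hh0])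
    linarith only [this, hx0]
  have h7 : h / 2 = r * L / (2 * π) := by rw [hh_def]; ring
  linarith only [h0, h1, h2, h3, h4, h5, h6, h7]

/-- **The small terms**: for `L ≥ 23`, `3.1354942 ≤ m ≤ L/2`, `r ≥ 401L`, `r ≥ 97000(1 + (L−23)/6)³`
and `S = (L/2 − m)²/(2π) + C₁ ≥ 0`: the lower-side remainder `log 2π + J₂ + J₃` and the upper-side
remainder `1 − log 2π + (L/(2π))S + 2L(L/2 − m + 1)/π² + (J₂ + J₃)(1 + 1/600)` are both `≤ 0.1 r`
(each is `≤ 1.84 + 0.007L³ + 2.34L² + 24.3L`). [folklore] -/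
private theorem junk_aux {r L m : ℝ} (hL23 : 23 ≤ L) (hm0 : 3.1354942 ≤ m) (hmL : m ≤ L / 2)
    (hr0 : 0 < r) (hrL : 401 * L ≤ r) (hrexp : 97000 * (1 + (L - 23) / 6) ^ 3 ≤ r)
    (hS0 : 0 ≤ ((L / 2 - m) ^ 2 / (2 * π) + C1)) :
    Real.log (2 * π) + (2 * 34.6 + 6.67 / 2 + 2 * 6.67 * (L / 2)) * L / π + 5 * 0.3725 / 3 * L ^ 2 / (2 * π ^ 2 * r) ≤ 0.1 * r ∧
      1 - Real.log (2 * π) + L / (2 * π) * ((L / 2 - m) ^ 2 / (2 * π) + C1) + 2 * L * (L / 2 - m + 1) / π ^ 2 +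
        ((2 * 34.6 + 6.67 / 2 + 2 * 6.67 * (L / 2)) * L / π + 5 * 0.3725 / 3 * L ^ 2 / (2 * π ^ 2 * r)) / 600 +
        (2 * 34.6 + 6.67 / 2 + 2 * 6.67 * (L / 2)) * L / π + 5 * 0.3725 / 3 * L ^ 2 / (2 * π ^ 2 * r) ≤ 0.1 * r := by
  have hπ := Real.pi_pos
  have hπ3 := Real.pi_gt_d2
  have hL0 : 0 < L := by linarith
  have hl2π := log_two_pi_bounds.2
  have hl2π' := one_le_log_two_pi
  have t2 : L / (2 * π) * ((L / 2 - m) ^ 2 / (2 * π) + C1) ≤ L ^ 3 / 144 + 0.00667 * L := by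
    have hS : ((L / 2 - m) ^ 2 / (2 * π) + C1) ≤ L ^ 2 / 24 + 0.04002 := by
      have h1 : (L / 2 - m) ^ 2 ≤ L ^ 2 / 4 := by
        have := mul_nonneg (show 0 ≤ m by linarith) (show 0 ≤ L - m by linarith)
        linarith
      have h2 : (L / 2 - m) ^ 2 / (2 * π) ≤ (L ^ 2 / 4) / 6 :=
        div_le_div₀ (by positivity) h1 (by norm_num) (by linarith)
      have h3 := C1_le'
      linarith
    have hL6 : L / (2 * π) ≤ L / 6 := div_le_div_of_nonneg_left hL0.le (by norm_num) (by linarith)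
    calc L / (2 * π) * ((L / 2 - m) ^ 2 / (2 * π) + C1) ≤ L / 6 * (L ^ 2 / 24 + 0.04002) :=
          mul_le_mul hL6 hS hS0 (by linarith)
      _ = L ^ 3 / 144 + 0.00667 * L := by ring
  have hπsq : 9 ≤ π ^ 2 := by
    have := mul_le_mul hπ3.le hπ3.le (by norm_num) hπ.le
    linarith
  have t3 : 2 * L * (L / 2 - m + 1) / π ^ 2 ≤ L ^ 2 / 9 := by
    have h1 : 2 * L * (L / 2 - m + 1) ≤ L ^ 2 := by
      have := mul_nonneg hL0.le (show 0 ≤ m - 1 by linarith)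
      linarith
    exact div_le_div₀ (by positivity) h1 (by norm_num) hπsq
  have t4 : (2 * 34.6 + 6.67 / 2 + 2 * 6.67 * (L / 2)) * L / π ≤ 24.1784 * L + 2.2234 * L ^ 2 := by
    have h1 : (2 * 34.6 + 6.67 / 2 + 2 * 6.67 * (L / 2)) * L / π ≤ (2 * 34.6 + 6.67 / 2 + 2 * 6.67 * (L / 2)) * L / 3 :=
      div_le_div_of_nonneg_left (mul_nonneg (by linarith) hL0.le) (by norm_num) (by linarith)
    have h2 : (2 * 34.6 + 6.67 / 2 + 2 * 6.67 * (L / 2)) * L / 3 ≤ 24.1784 * L + 2.2234 * L ^ 2 := by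
      have := sq_nonneg L
      linarith
    linarith
  have t5 : 5 * 0.3725 / 3 * L ^ 2 / (2 * π ^ 2 * r) ≤ 0.0001 * L := by
    rw [div_le_iff₀ (mul_pos (by positivity) hr0)]
    have h1 : 401 * L * L ≤ r * L := mul_le_mul_of_nonneg_right hrL hL0.le
    have h3 : 9 * (r * L) ≤ π ^ 2 * (r * L) :=
      mul_le_mul_of_nonneg_right hπsq (mul_nonneg hr0.le hL0.le)
    have hL2 := sq_nonneg L
    linarith
  have hjunk := junk_le_tenth hL23 hrexp
  have hL30 : 0 ≤ L ^ 3 := pow_nonneg hL0.le 3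
  have hL20 : 0 ≤ L ^ 2 := sq_nonneg L
  have hJ₂0 : 0 ≤ (2 * 34.6 + 6.67 / 2 + 2 * 6.67 * (L / 2)) * L / π := div_nonneg (mul_nonneg (by linarith) hL0.le) hπ.le
  have hJ₃0 : 0 ≤ 5 * 0.3725 / 3 * L ^ 2 / (2 * π ^ 2 * r) := div_nonneg (by positivity) (mul_nonneg (by positivity) hr0.le)
  have t20 : 0 ≤ L / (2 * π) * ((L / 2 - m) ^ 2 / (2 * π) + C1) := mul_nonneg (div_nonneg hL0.le (by positivity)) hS0
  constructor
  · linarith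
  · linarith

/-- **Core estimate, under RH, for `x ≥ e²³`**: with `L = log x`, `m = log log x`,
`|ψ(x) − x| ≤ √x·(L/(2π) + (L/2 − m)²/(2π) + C₁ + (L/2 − m + 1)/π + 0.1)`.
From `SchoenfeldBound.psi_sub_self_le` / `neg_le_psi_sub_self` (the explicit formula for `∫ψ`
differenced once, step `h = √x log x/π`), the zeros split at `T = 2π√x/log x`
(`sumInvNorm_le_explicit`: `∑_{|γ| ≤ T} 1/|ρ| ≤ log²(T/2π)/(2π) + C₁`, `log(T/2π) = L/2 − m`;
`tail_le_explicit`: `∑_{|γ|>T} 1/γ² ≤ 2G(T)`, main part `(L/2 − m + 1)·L/(2π²√x)`); all remaining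
terms are `≤ 1.84 + 0.007L³ + 2.34L² + 24.3L ≤ 0.1√x`. [cite: LeeNosal2026, Thm. 1.2 (statement); Schoenfeld1976, Thm. 10 (method)] -/
theorem abs_psi_sub_le_core (hRH : RiemannHypothesis) {x : ℝ} (hx : Real.exp 23 ≤ x) :
    |ψ x - x| ≤ Real.sqrt x * (Real.log x / (2 * π) +
      ((Real.log x / 2 - Real.log (Real.log x)) ^ 2 / (2 * π) + C1) +
      (Real.log x / 2 - Real.log (Real.log x) + 1) / π + 0.1) := by
  have hx0 : 0 < x := (Real.exp_pos 23).trans_le hx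
  have he23 : (24 : ℝ) ≤ Real.exp 23 := by linarith [Real.add_one_le_exp (23 : ℝ)]
  have hx1 : 1 < x := by linarith
  have hx2 : 2 ≤ x := by linarith
  -- name the quantities `L = log x`, `r = √x`, `m = log log x`
  obtain ⟨L, hL_def⟩ : ∃ L : ℝ, L = Real.log x := ⟨_, rfl⟩
  obtain ⟨r, hr_def⟩ : ∃ r : ℝ, r = Real.sqrt x := ⟨_, rfl⟩
  rw [← hL_def, ← hr_def]
  obtain ⟨m, hm_def⟩ : ∃ m : ℝ, m = Real.log L := ⟨_, rfl⟩
  rw [← hm_def]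
  have hπ := Real.pi_pos
  have hL23 : 23 ≤ L := by rw [hL_def]; exact (Real.le_log_iff_exp_le hx0).2 hx
  have hL0 : 0 < L := by linarith
  have hxL : Real.exp L = x := by rw [hL_def]; exact Real.exp_log hx0
  have hr : r = Real.exp (L / 2) := by rw [hr_def, ← hxL, Real.exp_half]
  have hr0 : 0 < r := by rw [hr]; exact Real.exp_pos _
  have hrx : r ^ 2 = x := by rw [hr_def]; exact Real.sq_sqrt hx0.le
  have hlogr : Real.log r = L / 2 := by rw [hr, Real.log_exp]
  have hm0 : 3.1354942 ≤ m := by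
    rw [hm_def]; exact le_trans log_23_ge (Real.log_le_log (by norm_num) hL23)
  have hm2 : 1.8378772 ≤ m := by linarith
  have hmL : m ≤ L / 2 := by rw [hm_def]; exact log_le_half hL0
  have hrexp : 97000 * (1 + (L - 23) / 6) ^ 3 ≤ r := by rw [hr]; exact exp_half_ge hL23
  have hrL : 401 * L ≤ r := by
    have hw : 0 ≤ (L - 23) / 6 := by linarith
    have hw2 : 0 ≤ ((L - 23) / 6) ^ 2 := sq_nonneg _
    have hw3 : 0 ≤ ((L - 23) / 6) ^ 3 := pow_nonneg hw 3
    have h3 : 1 + (L - 23) / 2 ≤ (1 + (L - 23) / 6) ^ 3 := by nlinarith [hw2, hw3]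
    have h4 := mul_le_mul_of_nonneg_left h3 (by norm_num : (0 : ℝ) ≤ 97000)
    linarith
  obtain ⟨hA, hA0, -, -⟩ := zeros_aux hRH hr0 hL0 hlogr hm_def hm2 hrL
  have hS0 : 0 ≤ ((L / 2 - m) ^ 2 / (2 * π) + C1) := hA0.trans hA
  have hlow := lower_aux hRH hx1 hrx hr0 hL0 hlogr hm_def hm2 hrL hL23
  have hup := upper_aux hRH hx1 hx2 hrx hr0 hL0 hlogr hm_def hm2 hmL hrL hL23
  obtain ⟨hj1, hj2⟩ := junk_aux hL23 hm0 hmL hr0 hrL hrexp hS0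
  have eM : r * L / (2 * π) + r * ((L / 2 - m) ^ 2 / (2 * π) + C1) + r * (L / 2 - m + 1) / π +
      0.1 * r = r * (L / (2 * π) + ((L / 2 - m) ^ 2 / (2 * π) + C1) + (L / 2 - m + 1) / π + 0.1) := by
    ring
  have e : (r + L / (2 * π)) * ((L / 2 - m) ^ 2 / (2 * π) + C1) =
      r * ((L / 2 - m) ^ 2 / (2 * π) + C1) + L / (2 * π) * ((L / 2 - m) ^ 2 / (2 * π) + C1) := by
    ring
  rw [abs_sub_le_iff]
  constructor
  · linarith only [hup, hj2, eM, e]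
  · linarith only [hlow, hj1, eM]

/-! ### Lee–Nosal, Theorem 1.2 (`ψ`), for `x ≥ 10¹⁰` -/

/-- **Under RH, for `x ≥ e²³`: `|ψ(x) − x| ≤ √x log x (log x − log log x)/(8π)`.**
[cite: LeeNosal2026, Thm. 1.2] -/
theorem abs_psi_sub_le_of_exp_le (hRH : RiemannHypothesis) {x : ℝ} (hx : Real.exp 23 ≤ x) :
    |ψ x - x| ≤ LeeNosal2026.bound x := by
  have hx0 : 0 < x := (Real.exp_pos 23).trans_le hx
  have hL23 : 23 ≤ Real.log x := (Real.le_log_iff_exp_le hx0).2 hx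
  have hL0 : 0 < Real.log x := by linarith
  have hm0 : 3.1354942 ≤ Real.log (Real.log x) :=
    le_trans log_23_ge (Real.log_le_log (by norm_num) hL23)
  have hmL : Real.log (Real.log x) ≤ Real.log x / 2 := log_le_half hL0
  have h1 := abs_psi_sub_le_core hRH hx
  have h2 := key_psi hL23 hm0 hmL C1_le'
  have h3 := mul_le_mul_of_nonneg_left h2 (Real.sqrt_nonneg x)
  rw [LeeNosal2026.bound_def]
  have e : Real.sqrt x * (Real.log x * (Real.log x - Real.log (Real.log x)) / (8 * π)) =
      Real.sqrt x * Real.log x * (Real.log x - Real.log (Real.log x)) / (8 * π) := by ring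
  linarith

/-- **Lee–Nosal 2026, Theorem 1.2 (the `ψ`-line) for `x ≥ 10¹⁰`, PROVED under RH** by the explicit
formula alone: `|ψ(x) − x| ≤ √x log x (log x − log log x)/(8π)`. (The printed theorem starts at
`x = 101`; the range `101 ≤ x < 10¹⁰` is numerical — see `psi_of_buthe`.) [cite: LeeNosal2026, Thm. 1.2] -/
theorem psi_large (hRH : RiemannHypothesis) {x : ℝ} (hx : (10 : ℝ) ^ 10 ≤ x) :
    |ψ x - x| ≤ LeeNosal2026.bound x :=
  abs_psi_sub_le_of_exp_le hRH (exp_23_le_ten_pow_ten.trans hx)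

/-! ### From `ψ` to `θ`: Theorem 1.2 (`θ`) for `x ≥ e³⁰` -/

/-- Under RH, for `x ≥ e³⁰`: `ψ(x) − θ(x) ≤ 1.0541 √x`, from
`ψ − θ ≤ ψ(√x) + ψ(x^{1/3}) + ψ(x^{1/5})` (Mathlib), `ψ(y) ≤ 1.04 y` (`SchoenfeldBound.psi_le_mul`) and
`x^{1/5} ≤ x^{1/3} ≤ √x/148` (`x^{1/6} ≥ e⁵ ≥ 148`). [cite: Schoenfeld1976, (6.13) (method)] -/
theorem psi_sub_theta_le_large (hRH : RiemannHypothesis) {x : ℝ} (hx : Real.exp 30 ≤ x) :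
    ψ x - θ x ≤ 1.0541 * Real.sqrt x := by
  have hx0 : 0 < x := (Real.exp_pos 30).trans_le hx
  obtain ⟨L, hL_def⟩ : ∃ L : ℝ, L = Real.log x := ⟨_, rfl⟩
  have hL30 : 30 ≤ L := by rw [hL_def]; exact (Real.le_log_iff_exp_le hx0).2 hx
  have hxL : Real.exp L = x := by rw [hL_def]; exact Real.exp_log hx0
  have hr : Real.sqrt x = Real.exp (L / 2) := by rw [← hxL, Real.exp_half]
  have h := Chebyshev.psi_sub_theta_le_psi_add_psi_add_psi x
  rw [rpow_half_eq_sqrt] at h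
  have e3 : x ^ ((3 : ℝ)⁻¹) = Real.exp (L / 3) := by
    rw [← hxL, ← Real.exp_mul]; ring_nf
  have e5 : x ^ ((5 : ℝ)⁻¹) = Real.exp (L / 5) := by
    rw [← hxL, ← Real.exp_mul]; ring_nf
  -- `e⁵ ≥ 148`
  have h148 : (148 : ℝ) ≤ Real.exp (L / 6) := by
    have h5 : Real.exp 5 = Real.exp 1 ^ 5 := by rw [← Real.exp_nat_mul]; norm_num
    have h5' : (2.7182818283 : ℝ) ^ 5 ≤ Real.exp 1 ^ 5 :=
      pow_le_pow_left₀ (by norm_num) Real.exp_one_gt_d9.le 5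
    calc (148 : ℝ) ≤ 2.7182818283 ^ 5 := by norm_num
      _ ≤ Real.exp 5 := by rw [h5]; exact h5'
      _ ≤ Real.exp (L / 6) := Real.exp_le_exp.2 (by linarith)
  have h3 : 148 * x ^ ((3 : ℝ)⁻¹) ≤ Real.sqrt x := by
    rw [e3, hr, show L / 2 = L / 6 + L / 3 by ring, Real.exp_add]
    exact mul_le_mul_of_nonneg_right h148 (Real.exp_pos _).le
  have h5 : x ^ ((5 : ℝ)⁻¹) ≤ x ^ ((3 : ℝ)⁻¹) := by
    rw [e3, e5]; exact Real.exp_le_exp.2 (by linarith)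
  have hA : ψ (Real.sqrt x) ≤ 1.04 * Real.sqrt x := psi_le_mul hRH (Real.sqrt_nonneg x)
  have hB : ψ (x ^ ((3 : ℝ)⁻¹)) ≤ 1.04 * x ^ ((3 : ℝ)⁻¹) := psi_le_mul hRH (by positivity)
  have hC : ψ (x ^ ((5 : ℝ)⁻¹)) ≤ 1.04 * x ^ ((5 : ℝ)⁻¹) := psi_le_mul hRH (by positivity)
  have hr0 := Real.sqrt_nonneg x
  linarith

/-- **Core estimate for `θ`, under RH, for `x ≥ e³⁰`**: with `L = log x`, `m = log log x`,
`|θ(x) − x| ≤ √x·(L/(2π) + (L/2 − m)²/(2π) + C₁ + (L/2 − m + 1)/π + 0.1 + 1.0541)`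
(`θ ≤ ψ` and `ψ − θ ≤ 1.0541√x`). [cite: LeeNosal2026, Thm. 1.2 (statement); Schoenfeld1976, Thm. 10 (method)] -/
theorem abs_theta_sub_le_core (hRH : RiemannHypothesis) {x : ℝ} (hx : Real.exp 30 ≤ x) :
    |θ x - x| ≤ Real.sqrt x * (Real.log x / (2 * π) +
      ((Real.log x / 2 - Real.log (Real.log x)) ^ 2 / (2 * π) + C1) +
      (Real.log x / 2 - Real.log (Real.log x) + 1) / π + 0.1 + 1.0541) := by
  have hx23 : Real.exp 23 ≤ x := le_trans (Real.exp_le_exp.2 (by norm_num)) hx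
  have h1 := abs_sub_le_iff.1 (abs_psi_sub_le_core hRH hx23)
  have h2 := psi_sub_theta_le_large hRH hx
  have h3 := Chebyshev.theta_le_psi x
  rw [abs_sub_le_iff]
  constructor
  · nlinarith [h1.1, h3, Real.sqrt_nonneg x]
  · nlinarith [h1.2, h2, Real.sqrt_nonneg x]

/-- **Under RH, for `x ≥ e³⁰`: `|θ(x) − x| ≤ √x log x (log x − log log x)/(8π)`.**
[cite: LeeNosal2026, Thm. 1.2] -/
theorem abs_theta_sub_le_of_exp_le (hRH : RiemannHypothesis) {x : ℝ} (hx : Real.exp 30 ≤ x) :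
    |θ x - x| ≤ LeeNosal2026.bound x := by
  have hx0 : 0 < x := (Real.exp_pos 30).trans_le hx
  have hL30 : 30 ≤ Real.log x := (Real.le_log_iff_exp_le hx0).2 hx
  have hL0 : 0 < Real.log x := by linarith
  have hm0 : 3.4011973 ≤ Real.log (Real.log x) :=
    le_trans log_30_ge (Real.log_le_log (by norm_num) hL30)
  have hmL : Real.log (Real.log x) ≤ Real.log x / 2 := log_le_half hL0
  have h1 := abs_theta_sub_le_core hRH hx
  have h2 := key_theta hL30 hm0 hmL C1_le'
  have h3 := mul_le_mul_of_nonneg_left h2 (Real.sqrt_nonneg x)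
  rw [LeeNosal2026.bound_def]
  have e : Real.sqrt x * (Real.log x * (Real.log x - Real.log (Real.log x)) / (8 * π)) =
      Real.sqrt x * Real.log x * (Real.log x - Real.log (Real.log x)) / (8 * π) := by ring
  linarith

/-- **Lee–Nosal 2026, Theorem 1.2 (the `θ`-line) for `x ≥ 10¹⁴`, PROVED under RH**:
`|θ(x) − x| ≤ √x log x (log x − log log x)/(8π)` (`e³⁰ < 10¹⁴`). [cite: LeeNosal2026, Thm. 1.2] -/
theorem theta_large (hRH : RiemannHypothesis) {x : ℝ} (hx : (10 : ℝ) ^ 14 ≤ x) :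
    |θ x - x| ≤ LeeNosal2026.bound x := by
  refine abs_theta_sub_le_of_exp_le hRH (le_trans ?_ hx)
  have h : (30 : ℝ) ≤ Real.log ((10 : ℝ) ^ 14) := by
    rw [Real.log_pow]; push_cast; linarith [log_ten_ge]
  calc Real.exp 30 ≤ Real.exp (Real.log ((10 : ℝ) ^ 14)) := Real.exp_le_exp.2 h
    _ = (10 : ℝ) ^ 14 := Real.exp_log (by positivity)

/-! ### Down to Lee–Nosal's thresholds modulo Büthe's numerical verification -/

/-- `0.94 √x ≤ √x log x (log x − log log x)/(8π)` for `x ≥ 350` (`L(L − log L) ≥ 23.9 ≥ 0.94·8π` for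
`L ≥ log 350 ≥ 5.8579`, using `log L ≤ log 6 + L/6 − 1`). [folklore] -/
private theorem buthe_psi_le_bound {x : ℝ} (hx : 350 ≤ x) : 0.94 * Real.sqrt x ≤ LeeNosal2026.bound x := by
  have hx0 : 0 < x := by linarith
  have hπ4 := Real.pi_lt_d2
  obtain ⟨L, hL_def⟩ : ∃ L : ℝ, L = Real.log x := ⟨_, rfl⟩
  have hL : 5.857933 ≤ L := by
    rw [hL_def]; exact le_trans log_350_ge (Real.log_le_log (by norm_num) hx)
  have hL0 : 0 < L := by linarith
  have hm : Real.log L ≤ 1.7917595 + (L / 6 - 1) := by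
    have h1 : Real.log L = Real.log 6 + Real.log (L / 6) := by
      rw [← Real.log_mul (by norm_num) (by positivity)]; congr 1; ring
    have h2 := Real.log_le_sub_one_of_pos (show 0 < L / 6 by positivity)
    linarith [log_6_le]
  have hkey : 0.94 * (8 * π) ≤ L * (L - Real.log L) := by
    have h1 : L * (5 / 6 * L - 0.7917595) ≤ L * (L - Real.log L) :=
      mul_le_mul_of_nonneg_left (by linarith) hL0.le
    have h2 : 5.857933 * (5 / 6 * L - 0.7917595) ≤ L * (5 / 6 * L - 0.7917595) :=
      mul_le_mul_of_nonneg_right hL (by linarith)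
    nlinarith [h1, h2]
  rw [LeeNosal2026.bound_def, ← hL_def]
  have hr0 := Real.sqrt_nonneg x
  have e : Real.sqrt x * L * (L - Real.log L) / (8 * π) =
      Real.sqrt x * (L * (L - Real.log L) / (8 * π)) := by ring
  rw [e]
  have : 0.94 ≤ L * (L - Real.log L) / (8 * π) := by
    rw [le_div_iff₀ (by positivity)]; exact hkey
  nlinarith [this, hr0]

/-- `1.95 √x ≤ √x log x (log x − log log x)/(8π)` for `x ≥ 3500` (`L(L − log L) ≥ 49.4 ≥ 1.95·8π` for
`L ≥ log 3500 ≥ 8.1605`, using `log L ≤ log 9 + L/9 − 1`). [folklore] -/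
private theorem buthe_theta_le_bound {x : ℝ} (hx : 3500 ≤ x) : 1.95 * Real.sqrt x ≤ LeeNosal2026.bound x := by
  have hx0 : 0 < x := by linarith
  have hπ4 := Real.pi_lt_d2
  obtain ⟨L, hL_def⟩ : ∃ L : ℝ, L = Real.log x := ⟨_, rfl⟩
  have hL : 8.160518 ≤ L := by
    rw [hL_def]; exact le_trans log_3500_ge (Real.log_le_log (by norm_num) hx)
  have hL0 : 0 < L := by linarith
  have hm : Real.log L ≤ 2.1972246 + (L / 9 - 1) := by
    have h1 : Real.log L = Real.log 9 + Real.log (L / 9) := by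
      rw [← Real.log_mul (by norm_num) (by positivity)]; congr 1; ring
    have h2 := Real.log_le_sub_one_of_pos (show 0 < L / 9 by positivity)
    linarith [log_9_le]
  have hkey : 1.95 * (8 * π) ≤ L * (L - Real.log L) := by
    have h1 : L * (8 / 9 * L - 1.1972246) ≤ L * (L - Real.log L) :=
      mul_le_mul_of_nonneg_left (by linarith) hL0.le
    have h2 : 8.160518 * (8 / 9 * L - 1.1972246) ≤ L * (8 / 9 * L - 1.1972246) :=
      mul_le_mul_of_nonneg_right hL (by linarith)
    nlinarith [h1, h2]
  rw [LeeNosal2026.bound_def, ← hL_def]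
  have hr0 := Real.sqrt_nonneg x
  have e : Real.sqrt x * L * (L - Real.log L) / (8 * π) =
      Real.sqrt x * (L * (L - Real.log L) / (8 * π)) := by ring
  rw [e]
  have : 1.95 ≤ L * (L - Real.log L) / (8 * π) := by
    rw [le_div_iff₀ (by positivity)]; exact hkey
  nlinarith [this, hr0]

/-- **Lee–Nosal 2026, Theorem 1.2 (`ψ`) for `x ≥ 350` — PROVED under RH modulo Büthe's (unconditional,
computer-assisted) Theorem 2**, `|x − ψ(x)| ≤ 0.94√x` for `11 < x ≤ 10¹⁹` (`Buthe2018_thm2_psi`): on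
`[350, 10¹⁹]` Büthe's bound is below Lee–Nosal's, above `10¹⁰` the explicit formula (`psi_large`) takes
over. (The printed range starts at `x = 101`; `101 ≤ x < 350` needs the tabulated `ψ`.)
[cite: LeeNosal2026, Thm. 1.2; Buthe2018, Thm. 2] -/
theorem psi_of_buthe (hB : Buthe2018_thm2_psi) (hRH : RiemannHypothesis) {x : ℝ} (hx : 350 ≤ x) :
    |ψ x - x| ≤ LeeNosal2026.bound x := by
  rcases le_or_gt x ((10 : ℝ) ^ 19) with h19 | h19
  · have h1 := hB x (by linarith) h19
    rw [abs_sub_comm] at h1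
    exact h1.trans (buthe_psi_le_bound hx)
  · exact psi_large hRH (le_trans (by norm_num) h19.le)

/-- **Lee–Nosal 2026, Theorem 1.2 (`θ`) for `x ≥ 3500` — PROVED under RH modulo Büthe's Theorem 2**,
`0.05√x < x − θ(x) ≤ 1.95√x` on `[1423, 10¹⁹]` (`Buthe2018_thm2_theta`): on `[3500, 10¹⁹]` Büthe's bound
is below Lee–Nosal's, above `10¹⁴` the explicit formula (`theta_large`) takes over. (The printed range
starts at `x = 2657`; `2657 ≤ x < 3500` needs the tabulated `θ`.) [cite: LeeNosal2026, Thm. 1.2; Buthe2018, Thm. 2] -/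
theorem theta_of_buthe (hB : Buthe2018_thm2_theta) (hRH : RiemannHypothesis) {x : ℝ}
    (hx : 3500 ≤ x) : |θ x - x| ≤ LeeNosal2026.bound x := by
  rcases le_or_gt x ((10 : ℝ) ^ 19) with h19 | h19
  · have h1 := hB.1 x (by linarith) h19
    have h2 := hB.2 x (by linarith) h19
    have h3 : 0 ≤ 0.05 * Real.sqrt x := by positivity
    rw [abs_sub_le_iff]
    constructor
    · linarith [buthe_theta_le_bound hx, Real.sqrt_nonneg x]
    · exact h1.trans (buthe_theta_le_bound hx)
  · exact theta_large hRH (le_trans (by norm_num) h19.le)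

end LeeNosalThm12

end Literature.NumberTheory.LFunctions

end
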